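import Mathlib
import HarnessLib
import HarnessLib.Audit
import Summits.CriticalPhenomena.Statement
import Literature.Probability.LatticeModels.PairIsing
import HarnessLib.Audit.Status.Attr

/-!
Route: ReflectionTwin

DORMANT since 2026-08-25T14:39:43Z (reconciler: no traction for 7.8 d (last activity item-evidence-added at 2026-08-17T19:17:14Z); parked, not closed — `ledger route dormant route-CriticalPhenomena-ReflectionTwin --off` to reactivate) — unstaffed, not closed; items shared with open routes are served there. `ledger route dormant <id> --off` reactivates.

# Route ReflectionTwin — a tenth mirror by crystal surgery — O(3) of the Z^3 limit is transparency
of the tuned (111) reflection twin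

It suffices to show X = (TT) ∧ (TH) together with the shared existence item (E) and the shared tail
(U′) ∧ (NG), realising idea card
reflection-twin-tenth-mirror (graded new-mechanism by the mechanism critic, 2026-08-16). OBJECT: the
(111) REFLECTION TWIN TW of ℤ³ —
slice ℤ³ by the planes h := x₀+x₁+x₂ = const (every n.n. bond joins consecutive layers), keep the
half-crystal H = {h ≤ 0}, and glue a second
copy of H along the plane C = {h = 0} by the IDENTITY of C (ℤ³ itself is the other double, glued by
the in-plane point inversion ι_C). TW is
symmetric under the Euclidean reflection θ in the plane x₀+x₁+x₂ = 0 (θ ∉ O_h) and REFLECTION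
POSITIVE across C for every symmetric seam
coupling (FILS site-plane form): a TENTH mirror that ℤ³ lacks. Typed on the vertex set ℤ³ (copy-2
site z ↦ −z; bonds = n.n. bonds of ℤ³
except those between layers 0 and 1, replaced by seam bonds {x, c}, h x = 1, h c = 0, x + c ∈
{e₀,e₁,e₂}; θ is realised EXACTLY by the graph
automorphism τ = −id off the plane, id on it), seam coupling J on the six bonds at each plane site,
bulk coupling 1, β = β_c(3), free boxes,
sup over boxes. (TH) TwinThreshold: the plane-ordering threshold J* := inf{J : plane long-range
order} is a CONTINUOUS threshold with J* > 0.
(TT) TwinTransparency (the card's TT′, BLIND form): for the bulk scaling-limit data (ρ, S) and any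
continuous threshold J, the twin
correlators renormalised by the SAME ρ converge locally uniformly, on non-coincident configurations
off the plane, to S_k read through SOME
linear map A above the plane (A = id on C, A preserves the upper half-space; identity below). (E) =
ExistsContinuousLimit (stmt-4582: the limit exists,
normalised, continuous on NonCoincident; no rotation clause — isotropy is OUTPUT), bridged by the
provable-now crux TwinRotationGlue, (U′) = InversionUpgradeNormalised (stmt-1982), (NG) =
IsingEuclidUpgradeR4NonGaussian (stmt-0636).
Lean: `TwinThreshold ∧ TwinTransparency ∧ ExistsContinuousLimit ∧ TwinRotationGlue ∧
InversionUpgradeNormalised ∧ IsingEuclidUpgradeR4NonGaussian`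

## Assembly
Pure logic (the crux-only deciding theorem `closes`, certified native at rev 3; `assembly_holds` and
`glue_of_supports` sorry-free in the
planner's Sketch2.lean, axioms propext/Classical.choice/Quot.sound): take (ρ, Δ, S) with its eight
properties from ExistsContinuousLimit;
TwinThreshold gives a continuous threshold J; TwinTransparency at (ρ, S, J) gives the blind map A
and the twin convergence; TwinRotationGlue
(= TwinReflectionSymmetry + TwinTransfer + CubicSymmetryOfLimit + MirrorClosure, the four supports)
turns these into IsRotationInvariant S, hence
IsEuclideanInvariant S := ⟨translation, rotation⟩; InversionUpgradeNormalised gives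
IsInversionCovariant Δ S and IsMoebiusCovariant Δ S := ⟨Euclid,
scale, inversion⟩; IsingEuclidUpgradeR4NonGaussian gives HasNontrivialU4 S; the tuple is
Literature.Probability.LatticeModels.CritIsing3DConformalLimit
= Ising3DConformalLimit (root abbrev). Every one of the six cruxes is a used hypothesis of `closes`.

Rationale: WHY THIS LINE. Clause (ii) of the conjunct contains O(3); on ℤ³ the two-point isotropy of any
scale-covariant limit is now a THEOREM in tree
(HyperoctahedralRP: HRP2Rigidity stmt-1979 and TwoPointLimitIsotropic stmt-1984, proved), but the
n-point upgrade (stmt-1980 / stmt-8367)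
is open and every engine for it is either analytic continuation in nine OS time directions, modular
theory, a Ward identity (VolterraWard)
or a planar import (PlanarCornerRotations). This line manufactures the missing symmetry instead: by
crystal surgery the (111) half-crystal
has exactly two doubles, ℤ³ (π-twisted, not positive) and the Σ3 twin TW (θ-symmetric, reflection
positive — FrohlichEtAl1978 §3 Thm 3.1 in
the site-plane form), and defect RG (BrayMoore1977; BurkhardtEisenriegler1981; KrishnanMetlitski2023
§1: the 'special' fixed point of a
symmetric plane defect in the 3D Ising class IS the defect-free bulk, its only relevant even
coupling ∫_C ε being tuned away by one
parameter, ∂_⊥ε excluded by the reflection symmetry) says the tuned twin is TRANSPARENT iff the two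
half-crystals carry the same continuum
theory, i.e. iff the bulk limit is θ-invariant. Given blind transparency, the θ-symmetry of TW is
transferred to the bulk limit by a
two-line argument (support TwinTransfer: the proved two-point isotropy pins A = id, then S_k∘θ = S_k
for EVERY k at once — no continuation
in n), and ⟨O_h, θ⟩ is dense in O(3) (support MirrorClosure: Niven's theorem on cos = −1/3 +
Cartan–Dieudonné), so IsRotationInvariant S
follows with continuity (part of the shared existence crux ExistsContinuousLimit, stmt-4582); the
four supports are bundled into the
provable-now bridge crux TwinRotationGlue, the form the crux-only deciding theorem consumes. WHY
EASIER than asserting isotropy: TwinTransparency is a statement about ONE reflection-positive,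
GKS-monotone one-parameter lattice family — RP across C holds for TW(J) at every J (an OS/transfer
structure in the very direction n = (1,1,1)/√3 where ℤ³ has none), plane order is monotone in J with
a threshold located by correlation inequalities, the blind form asks for no symmetry of the limit at
all, its k = 2 two-sided instance already pins A = id, and the free-field version is an exact
theorem (walk bijection); none of these handles exists for 'S_n is O(3)-invariant' stated bare
(stmt-1980/8367). Imported areas: reflection positivity of glued systems (constructive QFT /
FILS), defect and boundary RG of the 3D Ising class (statistical physics), finite reflection groups
and Niven's theorem (group theory /
number theory); the architecture is the blind-plus-one-mirror split of Beffara2008 /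
DKKMO2020Rotational realised in d = 3 without
integrability. Versus the negatives index: nothing on this sub-problem is refuted; versus the 48
open routes: none uses a bicrystal, a
non-lattice RP mirror or defect transparency (VolterraWard's twist walls are infinitesimal rotations
read as a Ward identity; HyperoctahedralRP
uses only the nine lattice mirrors).

RANKED CRUXES. #2 TwinTransparency (crux) — (card K1 = TT′, blind form) for every renormalisation ρ
> 0 on (0,1] and family S with HasPointwiseScalingLimit (criticalCorr 3) ρ S and S₂ > 0, and every
continuous plane-ordering threshold J of the (111) reflection twin at β_c(3) (no plane LRO at J,
plane LRO for all J′ > J, J > 0), there is a linear A : ℝ³ → ℝ³ fixing the plane x₀+x₁+x₂ = 0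
pointwise and preserving the open upper half-space such that for every k the twin k-point functions
(free boxes, sup over boxes, copy-2 points v read at the site −[θv/δ]) renormalised by ρ(δ)^k
converge, locally uniformly on non-coincident configurations with no point on the plane, to S_k of
the configuration with A applied to the points above the plane. [deps: TwinThreshold] [difficulty:
open-problem] (why it might fail: The tuned twin could flow to a NON-trivial θ-symmetric conformal
interface of the 3D Ising CFT (cross correlations then are no affine image of bulk ones) or be
transparent only up to an amplitude; and TT′ presupposes O(3) itself — an O_h-only limit makes TW an
interface θ·CFT|CFT.) [KrishnanMetlitski2023, BrayMoore1977, BurkhardtEisenriegler1981,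
FrohlichEtAl1978, DKKMO2020Rotational, Beffara2008]
#3 TwinThreshold (crux) — (card K2) at bulk β_c(3) the (111) reflection twin has a continuous,
strictly positive plane-ordering threshold: there is J* > 0 such that the infinite-volume free twin
state has no long-range order along the plane C at seam coupling J* (inf over plane sites c of
⟨σ₀σ_c⟩ is 0) but has plane long-range order for every J′ > J* (plane LRO is monotone in J by GKS
II; J* < ∞ by comparison with the decorated honeycomb bilayer carried by the seam bonds alone; J* >
0 because two ordinary surfaces are coupled by the irrelevant product of boundary spins, 2Δ̂_ord ≈
2.5 > 2). [difficulty: XL] (why it might fail: Plane order at arbitrarily small seam coupling (J* =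
0) cannot yet be excluded rigorously at bulk criticality, and the plane transition at J* may be
first order (LRO at J* itself); either empties the set of continuous thresholds.)
[FrohlichPfister1987I, KrishnanMetlitski2023, BurkhardtEisenriegler1981, FriedliVelenik2017,
AizenmanDuminilCopinSidoravicius2015]
#4 ExistsContinuousLimit (crux) — (shared item stmt-CriticalPhenomena-4582 =
LogPolarProxy.ExistsContinuousLimit, verbatim; existence WITHOUT rotations, with continuity) there
are ρ > 0 on (0,1], Δ > 0 and S with HasPointwiseScalingLimit (criticalCorr 3) ρ S, S = 0 off
NonCoincident, every S n continuous on NonCoincident 3 n, IsNondegenerateTwoPoint S,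
IsTranslationInvariant S, IsScaleCovariant Δ S. [difficulty: open-problem] (why it might fail: the
full δ→0⁺ limit with one Δ is open on ℤ³ (ICM2022 §8.4): c|x|⁻² ≤ G ≤ C|x|⁻¹ gives only
subsequential limits and Δ ∈ [1/2,1]; continuity of n-point limits needs a priori equicontinuity not
in print.) [DuminilCopinICM2022, AizenmanDuminilCopinSidoravicius2015, MessagerMiracleSoleJSP1977,
DuminilcopinPanis2025]
#5 TwinRotationGlue (crux) — (provable-now bridge, filed as a crux only because the deciding theorem
may assume cruxes only; precedent SubPtolemyInterlacing.InterlacingForcesU4) for every normalised,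
continuous-on-NonCoincident, non-degenerate, translation-invariant, scale-covariant pointwise limit
(ρ, Δ, S) of criticalCorr 3, blind transparency of the (111) reflection twin at some seam coupling J
through some linear A (A = id on the plane, A preserves the upper half-space) implies
IsRotationInvariant S. Proof = the four supports TwinReflectionSymmetry + TwinTransfer +
CubicSymmetryOfLimit (PROVED) + MirrorClosure (theorem glue_of_supports, Sketch2.lean, rc 0).
[difficulty: M] (why it might fail: only a slip in the typed twin encoding (site map / seam rule)
could break it; mathematically routine given the supports and the proved two-point isotropy.)
[DKKMO2020Rotational, Beffara2008, FrohlichEtAl1978]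
#6 InversionUpgradeNormalised (crux) — (shared item stmt-CriticalPhenomena-1982, verbatim) every
normalised, non-degenerate, Euclidean-invariant, scale-covariant pointwise scaling limit of
criticalCorr 3 is inversion covariant with the same Δ (hence Möbius); this route supplies its
Euclidean hypothesis. [difficulty: open-problem] (why it might fail: Scale + Euclid (+ RP) do not
force inversion covariance in general (free Maxwell d = 3; barrier ScaleCovarianceNotMoebius); for
Ising it rests on the absence of a Δ = 2 virial current, known only non-rigorously (DTW2016) and
numerically (Δ_V > 5).) [DelamotteTissierWschebor2016, PolandRychkovVichi2019, DuminilCopinICM2022]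
#7 IsingEuclidUpgradeR4NonGaussian (crux) — (shared item stmt-CriticalPhenomena-0636, verbatim)
every non-degenerate pointwise scaling limit of the renormalised critical Ising correlators on ℤ³
has U₄ ≢ 0 on non-coincident configurations. [difficulty: open-problem] (why it might fail:
Non-triviality in d = 3 is open: it needs the intersection probability of two independent sourced
double currents at macroscopic separation to stay positive as δ → 0 (Aizenman 1982); the theorems in
print go the other way (d = 4, RP long-range α ≤ 3/2).) [AizenmanDuminilCopinAnnals2021,
Aizenman1982, DuminilCopinICM2022]
#9 CubicSymmetryOfLimit (support) — (shared item stmt-CriticalPhenomena-6229 =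
MarkovRigidity.CubicSymmetryOfLimit, verbatim, PROVED in tree by cubicSymmetryOfLimit_proof) every
normalised, non-degenerate, translation-invariant, scale-covariant limit is invariant under the
hyperoctahedral group B₃ of linear isometries permuting {±e_i}. [difficulty: provable-now]
[FriedliVelenik2017, DuminilCopinICM2022]
#9 TwinReflectionSymmetry (support) — (lattice θ-symmetry of the twin, exact) for every seam
coupling J, every k and all lattice sites z₁…z_k off the plane (h zᵢ ≠ 0), the box-sup twin
correlator of σ_{−z₁}⋯σ_{−z_k} equals that of σ_{z₁}⋯σ_{z_k}: τ (negation off the plane, identity on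
it) is an automorphism of the weighted twin graph on every centred box (it maps n.n. bonds to n.n.
bonds, seam bonds {c, c−e_i} to seam bonds {c, e_i−c}, fixes the seam weights), so
PairIsing.gibbsAvg_comp_equiv_of_invariant applies box by box; checked combinatorially this session
(toys/twin_check.py: τ automorphism on [−3,3]³, all twin bonds of unit Euclidean length in the
embedding, plane sites trigonal-prismatic, closed-walk counts of TW and ℤ³ agree to length 8, rooted
self-avoiding 8-cycles through a plane site 3288 vs 3312 = the card's 1644 vs 1656). [difficulty:
provable-now] [FrohlichEtAl1978, FriedliVelenik2017]
#9 TwinTransfer (support) — (the card's transfer + dichotomy lemmas, with the dichotomy replaced by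
the PROVED two-point isotropy) for (ρ, Δ, S) as in ExistsContinuousLimit (continuity not needed
here): if for some J and some linear A (A = id on the plane, A preserves the upper half-space) the
ρ-renormalised twin correlators converge to S_k read through A above the plane, locally uniformly
off the plane, and the twin is τ-symmetric at the lattice level, then S_k(θx₁,…,θx_k) = S_k(x) for
all k and x. Proof: for v off the plane the copy sites satisfy site(θv) = −site(v) exactly (θ² = id,
h∘θ = −h, and h(site v) ≠ 0 by ⌊t⌋ ≤ t), so the two nets coincide and S_k(A♯x) = S_k(A♯θx); at k = 2
with f(v) := S₂(0,v) (continuous off 0, even, homogeneous, ISOTROPIC: twoPointKernelOfLimit_proof,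
twoPointLimitIsotropic_proof) and translation invariance, f(x − Bq) = f(Bx − q) for x, q below, B :=
Aθ; letting q tend to a plane point gives f∘B = f, hence ‖Bv‖ = ‖v‖, B orthogonal fixing the plane
pointwise, B ∈ {id, θ}, and B = id would make A = θ swap the half-spaces — so A = id, S_k = S_k∘θ
off the plane, on the plane by a normal translation, off NonCoincident by normalisation.
[difficulty: M] [DKKMO2020Rotational, Beffara2008, MessagerMiracleSoleJSP1977, DuminilCopinICM2022]
#9 MirrorClosure (support) — (pure group theory + topology) a correlation family on ℝ³ that vanishes
off NonCoincident, is continuous on NonCoincident, invariant under the hyperoctahedral group B₃ and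
under the reflection θ in the plane x₀+x₁+x₂ = 0 is O(3)-invariant (IsRotationInvariant). Proof: the
stabiliser G = {R ∈ O(3) : S∘R = S} is a closed subgroup (continuity on the open invariant set
NonCoincident, zero elsewhere); θ∘s_{e₀} ∈ G is the rotation about (0,1,−1) by the angle
2·arccos(1/√3), whose cosine −1/3 is rational but not in {0, ±1/2, ±1}, so by Niven's theorem
(Mathlib `niven`) the angle is an irrational multiple of π and its powers are dense in the rotations
about that axis (AddCircle.denseRange_zsmul_iff); closedness gives all rotations about (0,1,−1),
B₃-conjugation those about the orthogonal axis (0,1,1), Euler angles give SO(3) ⊆ G (equivalently: G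
is transitive on S² and contains the reflection s_{e₀}, hence every reflection, hence O(3) by
LinearIsometryEquiv.reflections_generate), and θ ∈ G ∖ SO(3) gives G = O(3). [difficulty: M]
[Mathlib niven, Mathlib LinearIsometryEquiv.reflections_generate, FrancescoMathieuSenechal1997]

TWO-LAYER PLAN. Foreseen glued splits (none filed now, D-0019): TwinTransparency ⇐
TwinTransparencyTwo (k = 2, two-sided: the only instance TwinTransfer
needs to pin A = id) → TwinTransparencyAll (all k, given k = 2 and a twin version of the
mirror-Hölder regularity) → TwinTransparency;
TwinThreshold ⇐ SeamOrderLarge (J large ⇒ plane LRO, Peierls/GKS comparison with the seam bilayer) →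
SeamDisorderSmall (J small ⇒ no plane
LRO at β_c(3): the J* > 0 half) → ThresholdContinuity (no LRO at J* itself) → TwinThreshold (k = 3,
depth 1).

KILL CRITERIA. A refutation of TwinTransparency at its k = 2 two-sided instance (e.g. a proof or
decisive Monte-Carlo evidence that at the located
threshold J* the cross-plane two-point function of the Σ3 twin is NOT asymptotic to the bulk one at
the mirror-image separation, for a
deviation that no seam coupling repairs) closes the route `refuted:TwinTransparency` (the supports
survive as Theorems lemmas; the card is
closed falsified). A theorem exhibiting a non-trivial ℤ₂×θ-symmetric codimension-one conformal
interface of the 3D Ising CFT with one relevant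
direction removes the defect-RG support of TwinTransparency — pivot to the TUNED-PAIR variant (two
seam parameters) or retire. TwinThreshold
refuted by J* = 0 (plane order at every J > 0) kills the line outright; refuted by a first-order
threshold ⇒ pivot to the weaker 'transparency
along a sequence J_n ↓ J*' form. ExistsContinuousLimit / InversionUpgradeNormalised /
IsingEuclidUpgradeR4NonGaussian refuted ⇒ the
conjunct itself is in doubt (CanonicalBranchRefutation territory). LimitRotationInvariant
(stmt-1980) proved elsewhere moots the route's
own cruxes but not its dividends (RP of the twin, the threshold, the 2D falsifier).

NOT DECOMPOSED YET. The two-sided k = 2 instance of TwinTransparency is not filed separately (it is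
the foreseen first child); the free-field anchor (one-sided
invisibility of TW for simple random walk / loop soups / the lattice GFF with any axis-dependent
weights, cross counts = balayage, conormal
versus mirror image — verified combinatorially to length 8 this session and to length 14 by the
card's author) is a dividend theorem, not an
item; reflection positivity of TW(J) across C (FILS) is used only inside proofs (regularity of the
twin family) and is not an antecedent of
`closes`; the 2D Pfaffian twin (the card's fastest refutation) is a falsifier, not an item; no
amplitude-renormalised variant of TT′ is filed
(the defect-free fixed point carries the bulk normalisation of σ on both sides).

CHEAPEST FALSIFIER. (i) The SOLVED dimension (unrun): on ℤ² build the reflection twin of a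
non-mirror rational line (e.g. 2x + y = 0); it is Pfaffian-exact,
and rotation invariance of the planar Ising CFT predicts ONE seam coupling meeting (cross exponent
1/4) ∧ (bulk amplitude) ∧ (no image
term) at once — three conditions, one parameter; no such coupling kills the equivalence behind
TwinTransparency. (ii) MC of the UNtuned
(111) twin at β_c = 0.221654626 (card author; in-plane 36² torus, 72 layers, 300+3000×3 Wolff
sweeps): cross-plane/same-side ratio of
normal-line correlations 1.002, 1.014, 1.016, 0.993, 0.982 (±0.015) at separations 3.5…17.3, plane
bond energy −0.24 % vs bulk —
transparent at the 1–2 % level; L = 48 runs queued by the card author (kit j004462–5, unreadable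
here). This session ran the exact
combinatorial checks of the TYPED encoding (toys/twin_check.py, seconds): τ is a graph automorphism,
every twin bond has unit length in
the embedding, plane sites are trigonal prisms, closed-walk counts of TW and ℤ³ agree (6, 90, 1860,
44730), same-side walk counts agree,
rooted 8-cycles through a plane site 3288 (TW) vs 3312 (ℤ³) = the card's 1644 vs 1656.

NUMBERS. Δ_σ = 0.5181489(10), Δ_ε = 1.412625(10) (bootstrap, PolandRychkovVichi2019) ⇒ plane-defect
relevance exponent y = 2 − Δ_ε = 0.587 > 0
(BurkhardtEisenriegler1981: y = 1/ν − 1; KrishnanMetlitski2023 §1), next even θ-symmetric defect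
perturbations irrelevant (T_⊥⊥: y = −1;
∂_⊥ε is θ-odd); ordinary boundary spin dimension Δ̂_ord ≈ 1.28 (2Δ̂_ord ≈ 2.55 > 2: weakly coupled
ordinary surfaces do not order,
KrishnanMetlitski2023 p.3); cos of the rotation θ∘s_{e₀} = −1/3 (irrational angle/π by Niven);
β_c(3) = 0.221654626(5) (MC); in tree at
β_c(3): c‖x‖⁻² ≤ ⟨σ₀σ_x⟩ ≤ C‖x‖⁻¹, Δ ∈ [1/2,1], two-point isotropy and B₃ symmetry of every
scale-covariant limit (stmt-1979/1983/1984/6229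
proved). Items after rev 4: 11 (own cruxes TwinTransparency, TwinThreshold, TwinRotationGlue; shared
cruxes ExistsContinuousLimit stmt-4582, InversionUpgradeNormalised stmt-1982,
IsingEuclidUpgradeR4NonGaussian stmt-0636; supports TwinReflectionSymmetry, TwinTransfer,
MirrorClosure, CubicSymmetryOfLimit; 1 assembly).

DEFINITION REQUESTS. None. Every constant exists and is `lean search --decl`-verified / elaborated
(Sketch.lean and the one-line rendering OneLine.lean, lean
check rc 0, no warnings): Literature.Probability.LatticeModels.{Site, box, spinAt, SpinConfig,
criticalBeta, criticalCorr, CorrFamily,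
HasPointwiseScalingLimit, latticeApprox, NonCoincident, IsNondegenerateTwoPoint,
IsTranslationInvariant, IsScaleCovariant, IsRotationInvariant,
IsEuclideanInvariant, IsInversionCovariant, HasNontrivialU4, PairIsing.gibbsAvg}, Mathlib
Submodule.reflection, Submodule.span (ℝ ∙ n)ᗮ,
EuclideanSpace.single, LinearIsometryEquiv, LinearMap, TendstoLocallyUniformlyOn, nhdsWithin, iSup,
Pi.single. The twin graph, seam
weights, copy sites and plane-LRO predicate are inlined as a shared `let` header (the route file
imports only the Statement and the fully
proved light module Literature.Probability.LatticeModels.PairIsing). Optional later (prover's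
helpers, not items): `twinGraph` as a
SimpleGraph on Site 3 and its reflection positivity across C.

Novelty: Searches (2026-08-16): `lit search --hybrid "twin boundary grain boundary Ising model critical point
reflection positivity"` (10 book hits:
Cai–Nix crystal defects, Friedli–Velenik, Cardy, MC handbooks — no twin/RP/isotropy link); `lit
search --source arxiv` ×4 ("Ising model twin
boundary critical" 0, "defect plane three-dimensional Ising renormalization group" 0, "conformal
interface three-dimensional Ising" 5 —
Saberi–Dashti 2010 percolation observables, DC lecture notes, none on interfaces, "reflection
positivity bicrystal" 0); `lit search --source
zbmath` ("plane defect O(N) model" → KrishnanMetlitski2023 arXiv:2301.05728 READ pp.1–3; "Ising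
grain boundary" 4, wetting/SOS only; "conformal
interface Ising" 8, planar CFT/SLE + GliozziEtAl2015 bootstrap of interfaces); `lit search --source
crossref` ×3 (Benyoussef–El Kenz 1993
interface delocalisation at a defect plane; Ebner 1990 defect-plane wetting; Burkhardt–Guim 1987 —
none on twins or isotropy); openalex/s2
rate-limited (429) at filing; the card author's 2026-08-15 log (arXiv ×5, galaxy ×2 incl. `lit
galaxy search "twin boundary Ising model" --star
all` = 0, crossref) and the mechanism critic's openalex queries (3 + 12, irrelevant); grep of all 51
Theses files of the sub for
twin|bicrystal|grain|seam|defect plane (VolterraWard's twist walls only) and the five-word lever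
list of all 48 open routes (NOTES.md).
Nearest prior art found: KrishnanMetlitski2023 (arXiv:2301.05728, §1: symmetric plane defect in the
3D O(N)/Isin  [refs: 2301.05728, KrishnanMetlitski2023, GliozziEtAl2015, BurkhardtEisenriegler1981, BrayMoore1977, FrohlichEtAl1978, Beffara2008, Kozma2007]

Barriers (technique_class: reflection-twin, crystal-surgery-rp, defect-transparency): - technique_class: reflection-twin, crystal-surgery-rp, defect-transparency,
linear-symmetry-dichotomy
- Literature.Barriers.CriticalPhenomena.EmbeddingModulusUniqueness: (transposed to d = 3: an input
shared by the anisotropic n.n./Gaussian family cannot give rotations) met head-on by the blind/aware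
split — TwinTransparency is deliberately BLIND (it holds with A = θ_Σ∘θ across the whole anisotropic
Gaussian family, where TW is one-sidedly invisible and cross counts are the balayage), and the AWARE
step is TwinTransfer, fed by the proved two-point isotropy / B₃.
- Literature.Barriers.CriticalPhenomena.LongRangeTrivialityOnZ3: its IsotropyAudit (G1) says the ℓ¹
long-range RP models keep GKS/Lebowitz/MMS/RP yet are anisotropic, so an isotropy proof must consume
n.n.-specific input — the surgery IS n.n.-specific (the two-doubles structure needs every bond to
join consecutive (111) layers; for longer range TW is neither a double of a half-crystal nor
reflection positive); clause (iii) is imported (stmt-0636), not engaged.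
- Literature.Barriers.CriticalPhenomena.ScaleCovarianceNotMoebius: not engaged by the own cruxes
(they deliver rotations, and its witnesses are isotropic); engaged only through the shared
InversionUpgradeNormalised exactly as on HyperoctahedralRP / GaussianScaleMixture /
OrthogonalFrameTP2 — it does not evade it; the bet there is Ising-specific input (vector gap),
staffed once for all isotropy routes.
- Literature.Barriers.CriticalPhenomena.LiouvilleRigidity: r

History (route lifecycle, newest last):
- 2026-08-16T21:33:06Z · rev 1: restated Assembly (stmt-CriticalPhenomena-16911) — rev 1: crux-only deciding theorem (glue.non-crux-hypothesis repair): existence crux ExistsContinuousLimit (stmt-4582) + provable-now bridge crux TwinRotationGlu (planner-plan-novel-CriticalPhenomena-Ising3DCon-3ad144fc-v2-)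
- 2026-08-16T21:34:31Z · rev 4: dropped ExistsScaleCovariantLimit, LimitContinuous — rev 4: drop ExistsScaleCovariantLimit (stmt-1981) and LimitContinuous (stmt-7043) from THIS route — both subsumed by the existence crux ExistsContinuousLimit (s (planner-plan-novel-CriticalPhenomena-Ising3DCon-3ad144fc-v2-)
- 2026-08-25T14:39:43Z · DORMANT — reconciler: no traction for 7.8 d (last activity item-evidence-added at 2026-08-17T19:17:14Z); parked, not closed — `ledger route dormant route-CriticalPhenomen (operator:999:1979968)

sub-problem: Ising3DConformalLimit · status: dormant · opened planner-plan-novel-CriticalPhenomena-Ising3DCon-3ad144fc-v2-g9-0 2026-08-16T21:30:52Z · rev 6 · ledger route-CriticalPhenomena-ReflectionTwin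
GENERATED by the gate from the ledger (D-0016/17). Provers cite these decls: `theorem foo : Summit.CriticalPhenomena.Ising3DConformalLimit.Theses.ReflectionTwin.<Decl> := …` in Summits/CriticalPhenomena/Ising3DConformalLimit/Theorems/<Name>.lean.
-/

namespace Summit.CriticalPhenomena.Ising3DConformalLimit.Theses.ReflectionTwin

open scoped BigOperators Topology Manifold Classical MeasureTheory ProbabilityTheory Matrix InnerProductSpace ComplexConjugate ContinuousMap
open Filter Set Function TopologicalSpace MeasureTheory

attribute [summit_statement] _root_.Ising3DConformalLimit

/-- item stmt-CriticalPhenomena-16905 · crux · rank 2 · open · by planner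
why it might fail: The tuned twin could flow to a NON-trivial θ-symmetric conformal interface of the 3D Ising CFT (cross correlations then are no affine image of bulk ones) or be transparent only up to an amplitude; and TT′ presupposes O(3) itself — an O_h-only limit makes TW an interface θ·CFT|CFT.
sources: KrishnanMetlitski2023, BrayMoore1977, BurkhardtEisenriegler1981, FrohlichEtAl1978, DKKMO2020Rotational, Beffara2008
[crux] (card K1 = TT′, blind form) for every renormalisation ρ > 0 on (0,1] and family S with
HasPointwiseScalingLimit (criticalCorr 3) ρ S and S₂ > 0, and every continuous plane-ordering
threshold J of the (111) reflection twin at β_c(3) (no plane LRO at J, plane LRO for all J′ > J, J >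
0), there is a linear A : ℝ³ → ℝ³ fixing the plane x₀+x₁+x₂ = 0 pointwise and preserving the open
upper half-space such that for every k the twin k-point functions (free boxes, sup over boxes,
copy-2 points v read at the site −[θv/δ]) renormalised by ρ(δ)^k converge, locally uniformly on
non-coincident configurations with no point on the plane, to S_k of the configuration with A applied
to the points above the plane. [deps: TwinThreshold] [difficulty: open-problem] -/
@[route_item "route-CriticalPhenomena-ReflectionTwin", crux]
def TwinTransparency : Prop :=
  open Literature.Probability.LatticeModels in (let E := EuclideanSpace ℝ (Fin 3); let nrm : E := EuclideanSpace.single 0 1 + EuclideanSpace.single 1 1 + EuclideanSpace.single 2 1; let θ : E → E := fun v => ((ℝ ∙ nrm)ᗮ).reflection v; let hZ : Site 3 → ℤ := fun z => z 0 + z 1 + z 2; let hR : E → ℝ := fun v => v 0 + v 1 + v 2; let Adj : Site 3 → Site 3 → Prop := fun a b => ((∑ i, |a i - b i| = 1) ∧ ¬ ((hZ a = 0 ∧ hZ b = 1) ∨ (hZ a = 1 ∧ hZ b = 0))) ∨ (((hZ a = 0 ∧ hZ b = 1) ∨ (hZ a = 1 ∧ hZ b = 0)) ∧ ∃ i : Fin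 3, a + b = Pi.single i 1); let cpl : ℝ → (L : ℕ) → ↥(box 3 L) → ↥(box 3 L) → ℝ := fun J _L a b => if Adj a.1 b.1 then (criticalBeta 3 / 2) * (if hZ a.1 = 0 ∨ hZ b.1 = 0 then J else 1) else 0; let twinLat : ℝ → (k : ℕ) → (Fin k → Site 3) → ℝ := fun J _k z => ⨆ L : ℕ, PairIsing.gibbsAvg (cpl J L) (fun s => ∏ i, if h : z i ∈ box 3 L then spinAt (⟨z i, h⟩ : ↥(box 3 L)) s else 0); let site : ℝ → E → Site 3 := fun δ v => if hR v ≤ 0 then latticeApprox δ v else -latticeApprox δ (θ v); let twinCorr : ℝ → ℝ → (k : ℕ) → (Fin k → E) → ℝ := fun J δ k w => twinLat J k (fun i => site δ (w i)); let LRO : ℝ → Prop := fun J => ∃ m : ℝ, 0 < m ∧ ∀ c : Site 3, hZ c = 0 → m ≤ twinLat J 2 ![0, c]; let IsSeamThreshold : ℝ → Prop := fun J => 0 < J ∧ ¬ LRO J ∧ ∀ J' : ℝ, J < J' → LRO J'; ∀ (ρ : ℝ → ℝ) (S : CorrFamily 3), (∀ δ ∈ Set.Ioc (0:ℝ) 1,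 0 < ρ δ) → HasPointwiseScalingLimit (criticalCorr 3) ρ S → IsNondegenerateTwoPoint S → ∀ J : ℝ, IsSeamThreshold J → ∃ A : E →ₗ[ℝ] E, (∀ v, hR v = 0 → A v = v) ∧ (∀ v, 0 < hR v → 0 < hR (A v)) ∧ ∀ k : ℕ, TendstoLocallyUniformlyOn (fun δ w => ρ δ ^ k * twinCorr J δ k w) (fun w => S k (fun i => if hR (w i) ≤ 0 then w i else A (w i))) (𝓝[>] (0:ℝ)) (NonCoincident 3 k ∩ {w | ∀ i, hR (w i) ≠ 0}))

/-- item stmt-CriticalPhenomena-16906 · crux · rank 3 · open · by planner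
why it might fail: Plane order at arbitrarily small seam coupling (J* = 0) cannot yet be excluded rigorously at bulk criticality, and the plane transition at J* may be first order (LRO at J* itself); either empties the set of continuous thresholds.
sources: FrohlichPfister1987I, KrishnanMetlitski2023, BurkhardtEisenriegler1981, FriedliVelenik2017, AizenmanDuminilCopinSidoravicius2015
[crux] (card K2) at bulk β_c(3) the (111) reflection twin has a continuous, strictly positive
plane-ordering threshold: there is J* > 0 such that the infinite-volume free twin state has no
long-range order along the plane C at seam coupling J* (inf over plane sites c of ⟨σ₀σ_c⟩ is 0) but
has plane long-range order for every J′ > J* (plane LRO is monotone in J by GKS II; J* < ∞ by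
comparison with the decorated honeycomb bilayer carried by the seam bonds alone; J* > 0 because two
ordinary surfaces are coupled by the irrelevant product of boundary spins, 2Δ̂_ord ≈ 2.5 > 2).
[difficulty: XL] -/
@[route_item "route-CriticalPhenomena-ReflectionTwin", crux]
def TwinThreshold : Prop :=
  open Literature.Probability.LatticeModels in (let hZ : Site 3 → ℤ := fun z => z 0 + z 1 + z 2; let Adj : Site 3 → Site 3 → Prop := fun a b => ((∑ i, |a i - b i| = 1) ∧ ¬ ((hZ a = 0 ∧ hZ b = 1) ∨ (hZ a = 1 ∧ hZ b = 0))) ∨ (((hZ a = 0 ∧ hZ b = 1) ∨ (hZ a = 1 ∧ hZ b = 0)) ∧ ∃ i : Fin 3, a + b = Pi.single i 1); let cpl : ℝ → (L : ℕ) → ↥(box 3 L) → ↥(box 3 L) → ℝ := fun J _L a b => if Adj a.1 b.1 then (criticalBeta 3 / 2) * (if hZ a.1 = 0 ∨ hZ b.1 = 0 then J else 1) else 0; let twinLat : ℝ → (k : ℕ) → (Fin k → Site 3) → ℝ := fun J _k z => ⨆ L : ℕ, PairIsing.gibbsAvg (cpl J L) (fun s => ∏ i, if h : z i ∈ box 3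 L then spinAt (⟨z i, h⟩ : ↥(box 3 L)) s else 0); let LRO : ℝ → Prop := fun J => ∃ m : ℝ, 0 < m ∧ ∀ c : Site 3, hZ c = 0 → m ≤ twinLat J 2 ![0, c]; let IsSeamThreshold : ℝ → Prop := fun J => 0 < J ∧ ¬ LRO J ∧ ∀ J' : ℝ, J < J' → LRO J'; ∃ J : ℝ, IsSeamThreshold J)

/-- item stmt-CriticalPhenomena-4582 · crux · rank 4 · open · by planner
why it might fail: The full δ→0⁺ limit of the critical ℤ³ correlators with one Δ is open (ICM2022 §8.4): c|x|⁻² ≤ G ≤ C|x|⁻¹ gives only subsequential limits and Δ ∈ [1/2,1]; continuity of n-point limits needs a priori equicontinuity not in print.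
sources: DuminilCopinICM2022, AizenmanDuminilCopinSidoravicius2015, MessagerMiracleSoleJSP1977, DuminilcopinPanis2025
[crux] there are ρ > 0 on (0,1], Δ > 0 and S : CorrFamily 3 with HasPointwiseScalingLimit
(criticalCorr 3) ρ S, S = 0 off NonCoincident, S n continuous on NonCoincident 3 n for every n,
IsNondegenerateTwoPoint S, IsTranslationInvariant S, IsScaleCovariant Δ S. This is
HyperoctahedralRP.ExistsScaleCovariantLimit (stmt-1981) plus CONTINUITY, which the transfer and the
group lemma need at rounding ties and axis-touching configurations and which is not automatic for
pointwise limits of step functions (x ↦ 1_{x₁ ≥ 0} is its own scaling limit); no rotation, no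
inversion clause — both are OUTPUT here. [difficulty: open-problem] -/
@[route_item "route-CriticalPhenomena-ReflectionTwin", crux]
def ExistsContinuousLimit : Prop :=
  ∃ (ρ : ℝ → ℝ) (Δ : ℝ) (S : Literature.Probability.LatticeModels.CorrFamily 3), (∀ δ ∈ Set.Ioc (0:ℝ) 1, 0 < ρ δ) ∧ 0 < Δ ∧ Literature.Probability.LatticeModels.HasPointwiseScalingLimit (Literature.Probability.LatticeModels.criticalCorr 3) ρ S ∧ (∀ n z, z ∉ Literature.Probability.LatticeModels.NonCoincident 3 n → S n z = 0) ∧ (∀ n, ContinuousOn (S n) (Literature.Probability.LatticeModels.NonCoincident 3 n)) ∧ Literature.Probability.LatticeModels.IsNondegenerateTwoPoint S ∧ Literature.Probability.LatticeModels.IsTranslationInvariant S ∧ Literature.Probability.LatticeModels.IsScaleCovariant Δ S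

/-- item stmt-CriticalPhenomena-16913 · crux · rank 5 · closed · proved by Summit.CriticalPhenomena.Ising3DConformalLimit.ReflectionTwinTwinRotationGlue.twinRotationGlue_proof @ 48e6a6de1fa5 (prover) · by planner
why it might fail: Only a slip in the typed twin encoding (site map / seam rule) could break it; mathematically routine given the four supports (glue_of_supports in Sketch2.lean, rc 0) and the proved two-point isotropy.
sources: DKKMO2020Rotational, Beffara2008, FrohlichEtAl1978
[crux] (provable-now bridge, filed as a crux only because the deciding theorem may assume cruxes
only — precedent SubPtolemyInterlacing.InterlacingForcesU4) TWIN ROTATION GLUE: for every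
normalised, continuous-on-NonCoincident, non-degenerate, translation-invariant, scale-covariant
pointwise scaling limit (ρ, Δ, S) of criticalCorr 3, blind transparency of the (111) reflection twin
at some seam coupling J through some linear A (A = id on the plane, A preserves the upper
half-space) implies IsRotationInvariant S. Proof = the four supports of this route:
TwinReflectionSymmetry (τ is an automorphism of the weighted twin graph,
PairIsing.gibbsAvg_comp_equiv_of_invariant) + TwinTransfer (the PROVED two-point isotropy
twoPointLimitIsotropic_proof and kernel facts twoPointKernelOfLimit_proof pin A = id and give S_k∘θ
= S_k) + CubicSymmetryOfLimit (B₃, PROVED: cubicSymmetryOfLimit_proof) + MirrorClosure (Niven on cos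
= −1/3, dense rotations about (0,1,−1), Cartan–Dieudonné); checked: theorem glue_of_supports in the
planner folder Sketch2.lean (rc 0). Why it might fail: only through a slip in the typed encoding of
the twin (site map, seam rule) — the combinatorial checks of toys/twin_check.p -/
@[route_item "route-CriticalPhenomena-ReflectionTwin", crux]
def TwinRotationGlue : Prop :=
  open Literature.Probability.LatticeModels in (let E := EuclideanSpace ℝ (Fin 3); let nrm : E := EuclideanSpace.single 0 1 + EuclideanSpace.single 1 1 + EuclideanSpace.single 2 1; let θ : E → E := fun v => ((ℝ ∙ nrm)ᗮ).reflection v; let hZ : Site 3 → ℤ := fun z => z 0 + z 1 + z 2; let hR : E → ℝ := fun v => v 0 + v 1 + v 2; let Adj : Site 3 → Site 3 → Prop := fun a b => ((∑ i, |a i - b i| = 1) ∧ ¬ ((hZ a = 0 ∧ hZ b = 1) ∨ (hZ a = 1 ∧ hZ b = 0))) ∨ (((hZ a = 0 ∧ hZ b = 1) ∨ (hZ a = 1 ∧ hZ b = 0)) ∧ ∃ i : Fin 3, a + b = Pi.single i 1); let cpl : ℝ → (L : ℕ) → ↥(box 3 L) → ↥(box 3 L) → ℝ := fun J _L a b =>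 if Adj a.1 b.1 then (criticalBeta 3 / 2) * (if hZ a.1 = 0 ∨ hZ b.1 = 0 then J else 1) else 0; let twinLat : ℝ → (k : ℕ) → (Fin k → Site 3) → ℝ := fun J _k z => ⨆ L : ℕ, PairIsing.gibbsAvg (cpl J L) (fun s => ∏ i, if h : z i ∈ box 3 L then spinAt (⟨z i, h⟩ : ↥(box 3 L)) s else 0); let site : ℝ → E → Site 3 := fun δ v => if hR v ≤ 0 then latticeApprox δ v else -latticeApprox δ (θ v); let twinCorr : ℝ → ℝ → (k : ℕ) → (Fin k → E) → ℝ := fun J δ k w => twinLat J k (fun i => site δ (w i)); ∀ (ρ : ℝ → ℝ) (Δ : ℝ) (S : CorrFamily 3), (∀ δ ∈ Set.Ioc (0:ℝ) 1, 0 < ρ δ) → HasPointwiseScalingLimit (criticalCorr 3) ρ S → (∀ n z, z ∉ NonCoincident 3 n → S n z = 0) → (∀ n, ContinuousOn (S n) (NonCoincident 3 n)) → IsNondegenerateTwoPoint S → IsTranslationInvariant S → IsScaleCovariant Δ S → (∃ (J : ℝ) (A : E →ₗ[ℝ] E), (∀ v, hR v = 0 → A v = v) ∧ (∀ v, 0 <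 hR v → 0 < hR (A v)) ∧ (∀ k : ℕ, TendstoLocallyUniformlyOn (fun δ w => ρ δ ^ k * twinCorr J δ k w) (fun w => S k (fun i => if hR (w i) ≤ 0 then w i else A (w i))) (𝓝[>] (0:ℝ)) (NonCoincident 3 k ∩ {w | ∀ i, hR (w i) ≠ 0}))) → IsRotationInvariant S)

/-- item stmt-CriticalPhenomena-1982 · crux · rank 5 · open · by planner
why it might fail: Scale + Euclid (+ RP) do not force inversion covariance in general (free Maxwell d = 3; barrier ScaleCovarianceNotMoebius); for Ising it rests on the absence of a Δ = 2 virial current, known only non-rigorously (DTW2016) and numerically (Δ_V > 5).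
sources: DelamotteTissierWschebor2016, PolandRychkovVichi2019, DuminilCopinICM2022
[crux r5, (D), inversion upgrade re-typed] Every pointwise scaling limit S of criticalCorr 3 (ρ > 0
on (0,1]) that is normalised (S = 0 off NonCoincident), non-degenerate, Euclidean invariant and
scale covariant with Δ is IsInversionCovariant Δ (hence Möbius). This is (U) of route
IsingEuclidUpgrade (item 0637, refuted AS TYPED by not_inversionUpgrade_of_euclideanLimit through
values on the coincident locus) with the normalisation hypothesis the refutation file prescribes;
the model-blind version is false (Literature.Barriers.CriticalPhenomena.ScaleCovarianceNotMoebius;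
free Maxwell d=3, ElshowkNakayamaRychkov2011), so any proof must use the Ising hypothesis (RP +
locality / absence of a dimension-2 virial current: DelamotteTissierWschebor2016 §5–6,
Nakayama2015). -/
@[route_item "route-CriticalPhenomena-ReflectionTwin", crux]
def InversionUpgradeNormalised : Prop :=
  ∀ (ρ : ℝ → ℝ) (Δ : ℝ) (S : Literature.Probability.LatticeModels.CorrFamily 3), (∀ δ ∈ Set.Ioc (0:ℝ) 1, 0 < ρ δ) → Literature.Probability.LatticeModels.HasPointwiseScalingLimit (Literature.Probability.LatticeModels.criticalCorr 3) ρ S → (∀ n z, z ∉ Literature.Probability.LatticeModels.NonCoincident 3 n → S n z = 0) → Literature.Probability.LatticeModels.IsNondegenerateTwoPoint S → Literature.Probability.LatticeModels.IsEuclideanInvariant S → Literature.Probability.LatticeModels.IsScaleCovariant Δ S → Literature.Probability.LatticeModels.IsInversionCovariant Δ S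

/-- item stmt-CriticalPhenomena-0636 · crux · rank 6 · open · by planner
why it might fail: Non-triviality in d = 3 is open: it needs the intersection probability of two independent sourced double currents at macroscopic separation to stay positive as δ → 0 (Aizenman 1982); the theorems in print go the other way (d = 4, RP long-range α ≤ 3/2).
sources: AizenmanDuminilCopinAnnals2021, Aizenman1982, DuminilCopinICM2022
Crux r4 (non-triviality in d=3): every non-degenerate pointwise scaling limit S of the renormalised
critical Ising correlators on Z^3 has connected four-point function U4 ≢ 0 on non-coincident
configurations. Intended tool: the random-current identity U4(x,y,z,t) =
−2⟨σxσy⟩⟨σzσt⟩·P^{xy,zt}[C_{n1+n2}(x) ∩ C_{n1+n2}(z) ≠ ∅] (Aizenman 1982; ADC2021 arXiv:1912.07973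
eq. (3.11)): non-Gaussianity ⇔ the intersection probability of the two double-current clusters at
macroscopic separation does not vanish as δ → 0. Contrast: for d ≥ 4 every such limit IS Gaussian
(Literature.Probability.LatticeModels.highDim_triviality). Its negation refutes the conjunct
Ising3DConformalLimit itself. -/
@[route_item "route-CriticalPhenomena-ReflectionTwin", crux]
def IsingEuclidUpgradeR4NonGaussian : Prop :=
  ∀ (ρ : ℝ → ℝ) (S : Literature.Probability.LatticeModels.CorrFamily 3), (∀ δ ∈ Set.Ioc (0:ℝ) 1, 0 < ρ δ) → Literature.Probability.LatticeModels.HasPointwiseScalingLimit (Literature.Probability.LatticeModels.criticalCorr 3) ρ S → Literature.Probability.LatticeModels.IsNondegenerateTwoPoint S → Literature.Probability.LatticeModels.HasNontrivialU4 S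

/-- item stmt-CriticalPhenomena-16907 · support · rank 9 · closed · proved by Summit.CriticalPhenomena.Ising3DConformalLimit.ReflectionTwinCubicSymmetryOfLimit.cubicSymmetryOfLimit_proof @ d2058d1b1d46 (prover) · by planner
sources: FriedliVelenik2017, DuminilCopinICM2022
[support] (shared item stmt-CriticalPhenomena-6229 = MarkovRigidity.CubicSymmetryOfLimit, verbatim,
PROVED in tree by cubicSymmetryOfLimit_proof) every limit as in ExistsScaleCovariantLimit is
invariant under the hyperoctahedral group B₃ of linear isometries permuting {±e_i}. [difficulty:
provable-now] -/
@[route_item "route-CriticalPhenomena-ReflectionTwin"]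
def CubicSymmetryOfLimit : Prop :=
  ∀ (ρ : ℝ → ℝ) (Δ : ℝ) (S : Literature.Probability.LatticeModels.CorrFamily 3), (∀ δ ∈ Set.Ioc (0:ℝ) 1, 0 < ρ δ) → Literature.Probability.LatticeModels.HasPointwiseScalingLimit (Literature.Probability.LatticeModels.criticalCorr 3) ρ S → (∀ n z, z ∉ Literature.Probability.LatticeModels.NonCoincident 3 n → S n z = 0) → Literature.Probability.LatticeModels.IsNondegenerateTwoPoint S → Literature.Probability.LatticeModels.IsTranslationInvariant S → Literature.Probability.LatticeModels.IsScaleCovariant Δ S → ∀ (L : EuclideanSpace ℝ (Fin 3) ≃ₗᵢ[ℝ] EuclideanSpace ℝ (Fin 3)), (∀ i : Fin 3, ∃ j : Fin 3, L (EuclideanSpace.single i 1) = EuclideanSpace.single j 1 ∨ L (EuclideanSpace.single i 1) = -EuclideanSpace.single j 1) → ∀ (n : ℕ) (x : Fin n → EuclideanSpace ℝ (Fin 3)), S n (fun k => L (x k)) = S n x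

/-- item stmt-CriticalPhenomena-16908 · support · rank 9 · open · by planner
sources: FrohlichEtAl1978, FriedliVelenik2017
[support] (lattice θ-symmetry of the twin, exact) for every seam coupling J, every k and all lattice
sites z₁…z_k off the plane (h zᵢ ≠ 0), the box-sup twin correlator of σ_{−z₁}⋯σ_{−z_k} equals that
of σ_{z₁}⋯σ_{z_k}: τ (negation off the plane, identity on it) is an automorphism of the weighted
twin graph on every centred box (it maps n.n. bonds to n.n. bonds, seam bonds {c, c−e_i} to seam
bonds {c, e_i−c}, fixes the seam weights), so PairIsing.gibbsAvg_comp_equiv_of_invariant applies box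
by box; checked combinatorially this session (toys/twin_check.py: τ automorphism on [−3,3]³, all
twin bonds of unit Euclidean length in the embedding, plane sites trigonal-prismatic, closed-walk
counts of TW and ℤ³ agree to length 8, rooted self-avoiding 8-cycles through a plane site 3288 vs
3312 = the card's 1644 vs 1656). [difficulty: provable-now] -/
@[route_item "route-CriticalPhenomena-ReflectionTwin"]
def TwinReflectionSymmetry : Prop :=
  open Literature.Probability.LatticeModels in (let hZ : Site 3 → ℤ := fun z => z 0 + z 1 + z 2; let Adj : Site 3 → Site 3 → Prop := fun a b => ((∑ i, |a i - b i| = 1) ∧ ¬ ((hZ a = 0 ∧ hZ b = 1) ∨ (hZ a = 1 ∧ hZ b = 0))) ∨ (((hZ a = 0 ∧ hZ b = 1) ∨ (hZ a = 1 ∧ hZ b = 0)) ∧ ∃ i : Fin 3, a + b = Pi.single i 1); let cpl : ℝ → (L : ℕ) → ↥(box 3 L) → ↥(box 3 L) → ℝ := fun J _L a b => if Adj a.1 b.1 then (criticalBeta 3 / 2) * (if hZ a.1 = 0 ∨ hZ b.1 = 0 then J else 1) else 0; let twinLat : ℝ → (k : ℕ) → (Fin k → Site 3) → ℝ := fun J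 _k z => ⨆ L : ℕ, PairIsing.gibbsAvg (cpl J L) (fun s => ∏ i, if h : z i ∈ box 3 L then spinAt (⟨z i, h⟩ : ↥(box 3 L)) s else 0); ∀ (J : ℝ) (k : ℕ) (z : Fin k → Site 3), (∀ i, hZ (z i) ≠ 0) → twinLat J k (fun i => -(z i)) = twinLat J k z)

/-- item stmt-CriticalPhenomena-16909 · support · rank 9 · closed · proved by Summit.CriticalPhenomena.Ising3DConformalLimit.ReflectionTwinTwinTransfer.twinTransfer_proof @ cdfaa9b5e06b (prover) · by planner
sources: DKKMO2020Rotational, Beffara2008, MessagerMiracleSoleJSP1977, DuminilCopinICM2022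
[support] (the card's transfer + dichotomy lemmas, with the dichotomy replaced by the PROVED
two-point isotropy) for (ρ, Δ, S) as in ExistsScaleCovariantLimit: if for some J and some linear A
(A = id on the plane, A preserves the upper half-space) the ρ-renormalised twin correlators converge
to S_k read through A above the plane, locally uniformly off the plane, and the twin is τ-symmetric
at the lattice level, then S_k(θx₁,…,θx_k) = S_k(x) for all k and x. Proof: for v off the plane the
copy sites satisfy site(θv) = −site(v) exactly (θ² = id, h∘θ = −h, and h(site v) ≠ 0 by ⌊t⌋ ≤ t), so
the two nets coincide and S_k(A♯x) = S_k(A♯θx); at k = 2 with f(v) := S₂(0,v) (continuous off 0,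
even, homogeneous, ISOTROPIC: twoPointKernelOfLimit_proof, twoPointLimitIsotropic_proof) and
translation invariance, f(x − Bq) = f(Bx − q) for x, q below, B := Aθ; letting q tend to a plane
point gives f∘B = f, hence ‖Bv‖ = ‖v‖, B orthogonal fixing the plane pointwise, B ∈ {id, θ}, and B =
id would make A = θ swap the half-spaces — so A = id, S_k = S_k∘θ off the plane, on the plane by a
normal translation, off NonCoincident by normalisation. [difficulty: M] -/
@[route_item "route-CriticalPhenomena-ReflectionTwin"]
def TwinTransfer : Prop :=
  open Literature.Probability.LatticeModels in (let E := EuclideanSpace ℝ (Fin 3); let nrm : E := EuclideanSpace.single 0 1 + EuclideanSpace.single 1 1 + EuclideanSpace.single 2 1; let θ : E → E := fun v => ((ℝ ∙ nrm)ᗮ).reflection v; let hZ : Site 3 → ℤ := fun z => z 0 + z 1 + z 2; let hR : E → ℝ := fun v => v 0 + v 1 + v 2; let Adj : Site 3 → Site 3 → Prop := fun a b => ((∑ i, |a i - b i| = 1) ∧ ¬ ((hZ a = 0 ∧ hZ b = 1) ∨ (hZ a = 1 ∧ hZ b = 0))) ∨ (((hZ a = 0 ∧ hZ b = 1) ∨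 (hZ a = 1 ∧ hZ b = 0)) ∧ ∃ i : Fin 3, a + b = Pi.single i 1); let cpl : ℝ → (L : ℕ) → ↥(box 3 L) → ↥(box 3 L) → ℝ := fun J _L a b => if Adj a.1 b.1 then (criticalBeta 3 / 2) * (if hZ a.1 = 0 ∨ hZ b.1 = 0 then J else 1) else 0; let twinLat : ℝ → (k : ℕ) → (Fin k → Site 3) → ℝ := fun J _k z => ⨆ L : ℕ, PairIsing.gibbsAvg (cpl J L) (fun s => ∏ i, if h : z i ∈ box 3 L then spinAt (⟨z i, h⟩ : ↥(box 3 L)) s else 0); let site : ℝ → E → Site 3 := fun δ v => if hR v ≤ 0 then latticeApprox δ v else -latticeApprox δ (θ v); let twinCorr : ℝ → ℝ → (k : ℕ) → (Fin k → E) → ℝ := fun J δ k w => twinLat J k (fun i => site δ (w i)); ∀ (ρ : ℝ → ℝ) (Δ : ℝ) (S : CorrFamily 3), (∀ δ ∈ Set.Ioc (0:ℝ) 1, 0 < ρ δ) → HasPointwiseScalingLimit (criticalCorr 3) ρ S → (∀ n z, z ∉ NonCoincident 3 n → S n z = 0) → IsNondegenerateTwoPoint S → IsTranslationInvariant S → IsScaleCovariant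 Δ S → (∃ (J : ℝ) (A : E →ₗ[ℝ] E), (∀ v, hR v = 0 → A v = v) ∧ (∀ v, 0 < hR v → 0 < hR (A v)) ∧ (∀ k : ℕ, TendstoLocallyUniformlyOn (fun δ w => ρ δ ^ k * twinCorr J δ k w) (fun w => S k (fun i => if hR (w i) ≤ 0 then w i else A (w i))) (𝓝[>] (0:ℝ)) (NonCoincident 3 k ∩ {w | ∀ i, hR (w i) ≠ 0})) ∧ (∀ (k : ℕ) (z : Fin k → Site 3), (∀ i, hZ (z i) ≠ 0) → twinLat J k (fun i => -(z i)) = twinLat J k z)) → ∀ (k : ℕ) (w : Fin k → E), S k (fun i => θ (w i)) = S k w)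

/-- item stmt-CriticalPhenomena-16910 · support · rank 9 · open · by planner
sources: Mathlib niven, Mathlib LinearIsometryEquiv.reflections_generate, FrancescoMathieuSenechal1997
[support] (pure group theory + topology) a correlation family on ℝ³ that vanishes off NonCoincident,
is continuous on NonCoincident, invariant under the hyperoctahedral group B₃ and under the
reflection θ in the plane x₀+x₁+x₂ = 0 is O(3)-invariant (IsRotationInvariant). Proof: the
stabiliser G = {R ∈ O(3) : S∘R = S} is a closed subgroup (continuity on the open invariant set
NonCoincident, zero elsewhere); θ∘s_{e₀} ∈ G is the rotation about (0,1,−1) by the angle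
2·arccos(1/√3), whose cosine −1/3 is rational but not in {0, ±1/2, ±1}, so by Niven's theorem
(Mathlib `niven`) the angle is an irrational multiple of π and its powers are dense in the rotations
about that axis (AddCircle.denseRange_zsmul_iff); closedness gives all rotations about (0,1,−1),
B₃-conjugation those about the orthogonal axis (0,1,1), Euler angles give SO(3) ⊆ G (equivalently: G
is transitive on S² and contains the reflection s_{e₀}, hence every reflection, hence O(3) by
LinearIsometryEquiv.reflections_generate), and θ ∈ G ∖ SO(3) gives G = O(3). [difficulty: M] -/
@[route_item "route-CriticalPhenomena-ReflectionTwin"]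
def MirrorClosure : Prop :=
  open Literature.Probability.LatticeModels in (let E := EuclideanSpace ℝ (Fin 3); let nrm : E := EuclideanSpace.single 0 1 + EuclideanSpace.single 1 1 + EuclideanSpace.single 2 1; let θ : E → E := fun v => ((ℝ ∙ nrm)ᗮ).reflection v; ∀ (S : CorrFamily 3), (∀ n z, z ∉ NonCoincident 3 n → S n z = 0) → (∀ n, ContinuousOn (S n) (NonCoincident 3 n)) → (∀ (L : E ≃ₗᵢ[ℝ] E), (∀ i : Fin 3, ∃ j : Fin 3, L (EuclideanSpace.single i 1) = EuclideanSpace.single j 1 ∨ L (EuclideanSpace.single i 1) = -EuclideanSpace.single j 1) → ∀ (n : ℕ) (x : Fin n → E), S n (fun k => L (x k)) = S n x) → (∀ (n : ℕ) (x : Fin n → E), S n (fun k => θ (x k)) = S n x) → IsRotationInvariant S)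

-- earlier Assembly (stmt-CriticalPhenomena-16911, replaced 2026-08-16T21:33:06Z -> stmt-CriticalPhenomena-16914): retired by None — TwinThreshold → TwinTransparency → ExistsScaleCovariantLimit → LimitContinuous → CubicSymmetryOfLimit → TwinReflectionSymmetry → TwinTransfer → MirrorClosure → InversionUpgradeNormalised → IsingEuclidUpgradeR4NonGaussian → Ising3DConformalLimit
/-- item stmt-CriticalPhenomena-16914 · assembly · rank 1 · closed · proved by Summit.CriticalPhenomena.Ising3DConformalLimit.ReflectionTwinAssembly.assembly_proof @ b1b02cc33b11 (prover) · by planner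
sources: DuminilCopinICM2022, KrishnanMetlitski2023
[assembly] TwinThreshold → TwinTransparency → ExistsContinuousLimit → TwinRotationGlue →
InversionUpgradeNormalised → IsingEuclidUpgradeR4NonGaussian → Ising3DConformalLimit (rev 1:
crux-only spine; the supports TwinReflectionSymmetry / TwinTransfer / CubicSymmetryOfLimit /
MirrorClosure prove TwinRotationGlue). -/
@[route_item "route-CriticalPhenomena-ReflectionTwin"]
def Assembly : Prop :=
  TwinThreshold → TwinTransparency → ExistsContinuousLimit → TwinRotationGlue → InversionUpgradeNormalised → IsingEuclidUpgradeR4NonGaussian → Ising3DConformalLimit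

/-! D-0027 §2.1 — DECIDING THEOREM (planner-authored via `route open/edit --closes-file`; by planner-plan-novel-CriticalPhenomena-Ising3DCon-3ad144fc-v2- 2026-08-16T21:34:07Z):
its hypotheses are this route's items and its conclusion the sub-problem Statement (glue_lint), and it elaborates with this file. -/

@[closes "route-CriticalPhenomena-ReflectionTwin"] theorem closes (hT : TwinThreshold) (hTT : TwinTransparency) (hE : ExistsContinuousLimit)
    (hG : TwinRotationGlue) (hI : InversionUpgradeNormalised) (hN : IsingEuclidUpgradeR4NonGaussian) :
    _root_.Ising3DConformalLimit := by
  obtain ⟨ρ, Δ, S, hρ, hΔ, hlim, hnorm, hcont, hnd, htr, hsc⟩ := hE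
  obtain ⟨J, hJ⟩ := hT
  obtain ⟨A, hAfix, hAup, hconv⟩ := hTT ρ S hρ hlim hnd J hJ
  have hrot : Literature.Probability.LatticeModels.IsRotationInvariant S :=
    hG ρ Δ S hρ hlim hnorm hcont hnd htr hsc ⟨J, A, hAfix, hAup, hconv⟩
  have heuc : Literature.Probability.LatticeModels.IsEuclideanInvariant S := ⟨htr, hrot⟩
  exact ⟨ρ, Δ, S, hρ, hΔ, hlim, hnd, ⟨heuc, hsc, hI ρ Δ S hρ hlim hnorm hnd heuc hsc⟩, hN ρ S hρ hlim hnd⟩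

end Summit.CriticalPhenomena.Ising3DConformalLimit.Theses.ReflectionTwin
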